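import Literature.MathematicalPhysics.QuantumFieldTheory.Balaban1983to89.B15ShellGauge193
import Literature.MathematicalPhysics.QuantumFieldTheory.Balaban1983to89.B15Prop1Carrier

/-!
# `Balaban1983to89.B15ShellGauge193Local` — [Balaban1989LargeFieldI] p. 193: the shell-gauge extension of a regular
# configuration to a parallelepiped `Λ` (`d ≥ 3`, ALL plaquettes, `B15ShellGauge193`) UNDER THE LOCAL HYPOTHESIS
# *«|V_k(∂p′) − 1| < ε for p′ ⊂ Z∩Λᶜ»* — only the plaquettes of the enlarged box `[lo − 1, hi + 1]` lying off `Λ` are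
# assumed small — and the extension letters (ℓ2) of Proposition 1 [IV] at the carrier of record `B15Prop1Carrier.lfVarOn`

statement-level skeleton of published theorems with citation tags; proofs where landed; nothing here is a claim about
the Yang–Mills mass gap.

T. Bałaban, *Large field renormalization. I. The basic step of the 𝐑 operation*, Commun. Math. Phys. **122** (1989) 175–202
[Balaban1989LargeFieldI] («[IV]»), p. 193 (PDF held `paper:balaban1989-cmp122-large-field-i`, journal page = PDF page + 174),
verbatim: *"Take a configuration V_k defined on Z∩Λ^c and satisfying the regularity condition |V_k(∂p′) − 1| < ε for
p′ ⊂ Z∩Λ^c, ε > 0 is sufficiently small. … Introduce a generalized axial gauge on the surface ∂⁺Λ. … we get a configuration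
V_k defined on the whole domain, equal to the given one on Z∩Λ^c, and satisfying the regularity condition |∂V_k − 1| <
O(1)M²ε."*; Proposition 1 p. 194: *"Let us consider a configuration V_k satisfying the above regularity condition, i.e.,
|V_k(∂p′) − 1| < ε for p′ ⊂ (Z∩Λ^c)^{(k)}"*.

Cell pub-ymgap, HUMAN RULING D-0062 (Track A full width), seat `pub-ymgap-dag-n12-c` (R134 acceleration seat (a), strategy s1 of
DAG node N12 = [B15]; generation g3, first product).

WHY THIS FILE.  `B15ShellGauge193` (lit-balaban r12, GAPS G-B15-02 repaired for `d ≥ 3`) PROVES the p. 193 extension for a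
parallelepiped with ALL plaquettes regular (`extension_shell_box`: `|V̂(∂p) − 1| ≤ 12d(n + 2)²ε`), from the GLOBAL torus
hypothesis `PlaqSmallOn (outPlaqs Λ) ε V` — EVERY plaquette of the torus without a corner in `Λ` is `ε`-small (its `ℤ^d`
pull-back `ShellPlaqSmall` quantifies over the unbounded slabs `{z_κ₀ = lo_κ₀ − 1} ∪ {z_κ₀ = hi_κ₀ + 1}`).  Print's hypothesis,
and the `Regular` clause of the Proposition-1 carrier of record `B15Prop1Carrier.lfVarOn` (`PlaqSmallOn (plaqsInside (pts k
(Z ∩ Λᶜ))) ε V_k`), is LOCAL: only the plaquettes `p′ ⊂ Z ∩ Λᶜ` are small, and the construction reads only the plaquettes of the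
enlarged box `[lo − 1, hi + 1] ⊂ Z`.  This file derives r12's conclusions from the local hypothesis (a clamping device at the
`ℤ^d` level, no line of r12's proof re-run) and discharges the three extension letters `hext0` ∕ `hextZ` ∕ `hextΛ` of
`B15Prop1CarrierOnSU2Box(Ineq19).prop1Printed_lfVarOn_su2_box_…` (dag-n12-c g2, p470158 ∕ p473804) in their own shape.

WHAT IS PROVED (theorems only; Mathlib + the two imports; no `sorry`, no definition, no `… : Prop` fact; axioms standard).
§1 `ℤ^d`, any `GaugeGroup` (private [folklore] bookkeeping `hol_congr_of_forward` — transport along a word of forward letters reads only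
   the bonds of the box it sweeps —, `forward_of_mem_tw`, `frozen_add_e`): `forward_of_mem_pathWord` (r12's shell path `Γ_y` is a forward
   word for `y` above the corner `lo − 1`), **`exists_clamped`** (THE CLAMP: `V♭(z, μ) := V(c z, μ)` when the coordinate-wise clamping `c` to
   `[lo − 1, hi + 1]` maps the bond `⟨z, z + e_μ⟩` to a bond, `:= 1` when it collapses it; `V♭ = V` on the bonds of the big box,
   and a plaquette of `V♭` is either a plaquette of `V` INSIDE the big box with the same frozen coordinate or has holonomy
   `1` — so the LOCAL hypothesis for `V` gives r12's GLOBAL `ShellPlaqSmall V♭ lo hi ε`), `shellFn_congr`, `gaugeAct_shellFn_congr`,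
   and **`dist1_shellAct_le_local`**: r12's `dist1_shellAct_le` (`|V^g(b) − 1| ≤ 3d(n + 2)²ε` on every shell bond, `d ≥ 3`) from
   the local hypothesis, BY NAME on `V♭`.
§2 torus (`Site P k`): `plaq_mem_local_of_frozen` (the pull-back dictionary: a big-box `ℤ^d` plaquette with a frozen third coordinate
   is a torus plaquette of `boxPlaqs (lo − 1) (hi + 1)` off `boxSites lo hi`), **`dist1_gaugeAct_shellGauge_le_local`** and
   **`extension_shell_box_local`** = r12's `dist1_gaugeAct_shellGauge_le` ∕ `extension_shell_box` with the hypothesis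
   `PlaqSmallOn S₀ ε V`, `S₀ ⊇ boxPlaqs (lo − 1) (hi + 1) ∩ outPlaqs (boxSites lo hi)`.
§3 AT THE CARRIER OF RECORD (`pts k Λ = castSite '' [lo, hi]`, `boxPlaqs (lo − 1) (hi + 1) ⊆ plaqsInside (pts k Z)` — the
   conventions of `B15Prop1RelativeAxialGauge` ∕ `B15Prop1CarrierOnSU2Box`; private `boxSites_eq_image`): `mem_outPlaqs_iff_not_mem_plaqsOf`,
   **`extend_mem_extSet`** (letter `hext0`: the extension equals `V_k` off the bonds meeting `Λ^{(k)}`), and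
   **`dist1_plaqHol_extend_shellGauge_le`** (letters `hextZ` ∕ `hextΛ`: under `lfVarOn`'s `Regular i ε V_k` EVERY plaquette
   `p′ ⊂ Z^{(k)}` and every plaquette meeting `Λ^{(k)}` of the extension `extend (pts k Λ) (shellGauge V_k lo hi) V_k` has
   `|V̂(∂p′) − 1| ≤ 12d(n + 2)²ε`, `d ≥ 3`, no smallness threshold).

HONEST SCOPE.  (i) `d ≥ 3` is essential (r12's reading note: in `d = 2` the holonomy around `Λ` is gauge invariant and not
controlled by the plaquettes of `Λᶜ`); the papers have `d = 3, 4`.  (ii) One parallelepiped `Λ` (print p. 192: *"it is a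
rectangular parallelepiped contained in a cube of the size 100M"*).  (iii) Constant `12d(n + 2)²` (`n + 1` ≥ sites per direction)
— print's `O(1)M²` with `n + 1 ≤ 100M`.  (iv) Nothing here concerns the function (1.77), its critical orbits, or the expansion
pieces of [LF-II] pp. 357–359; the remaining letters of the N12∕s1 chain ((1.7), (m2)–(m5), (c3), (c3″), (x), thresholds) are
untouched.  Count-neutral kernel work on Bałaban AS PRINTED; NOT a discharge of N12; NOT summit progress.
-/

noncomputable section

open Set

namespace Literature.MathematicalPhysics.QuantumFieldTheory.Balaban1983to89.B15ShellGauge193Local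

open B7Prop1Explicit (Letter e e_apply disp disp_nil disp_cons disp_append hol hol_nil hol_cons stepHol stepHol_true seg
  seg_natCast plaqWord gaugeAct)
open B7Prop1Local (hol_plaqWord_eq)
open B8Lemma1NonAbelian (tw e_nonneg disp_nonneg_of_forward)
open B15ShellGauge193 (Frozen ShellPlaqSmall shellFn pathWord vUp vLo bot_add_disp_pathWord dist1_shellAct_le)

/-! ## §1  `ℤ^d`: transport along forward words, the clamp, r12's shell-bond bound under the local hypothesis -/

section Zd

variable {d : ℕ} {G : Type*} [GaugeGroup G]

/-- **Transport along a forward word reads only the bonds it sweeps**: if every letter of `w` is a forward step, the parallel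
transports of `V` and `V′` along `w` from `x` agree as soon as `V′ = V` on the bonds `⟨z, z + e_μ⟩` with
`x ≤ z`, `z + e_μ ≤ x + disp w`. [folklore] -/
private theorem hol_congr_of_forward (V V' : (Fin d → ℤ) → Fin d → G) :
    ∀ (w : List (Letter d)) (x : Fin d → ℤ), (∀ l ∈ w, l = (l.1, true)) →
      (∀ (z : Fin d → ℤ) (μ : Fin d), x ≤ z → z + e μ ≤ x + disp w → V' z μ = V z μ) →
      hol V' x w = hol V x w
  | [], _, _, _ => by simp
  | l :: w, x, hfw, hV => by
    obtain ⟨μ, b⟩ := l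
    have hl : ((μ, b) : Letter d) = (μ, true) := hfw (μ, b) (by simp)
    have hb : b = true := by simpa using congrArg Prod.snd hl
    subst hb
    have hfw' : ∀ l' ∈ w, l' = (l'.1, true) := fun l' hl' => hfw l' (List.mem_cons_of_mem _ hl')
    have h0 : (0 : Fin d → ℤ) ≤ disp w := disp_nonneg_of_forward hfw'
    rw [hol_cons, hol_cons, stepHol_true, stepHol_true, Letter.vec_true]
    have h1 : V' x μ = V x μ := hV x μ le_rfl (by
      rw [disp_cons, Letter.vec_true, ← add_assoc]
      exact le_add_of_nonneg_right h0)
    rw [h1, hol_congr_of_forward V V' w (x + e μ) hfw' (fun z μ' hz hz' => hV z μ'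
      ((le_add_of_nonneg_right (e_nonneg μ)).trans hz) (by rwa [disp_cons, Letter.vec_true, ← add_assoc]))]

/-- The multi-segment word `tw ks v` of a non-negative vector `v` consists of forward letters. [folklore] -/
private theorem forward_of_mem_tw {ks : List (Fin d)} {v : Fin d → ℤ} (hv : 0 ≤ v) {l : Letter d} (hl : l ∈ tw ks v) :
    l = (l.1, true) := by
  unfold tw at hl
  rw [List.mem_flatMap] at hl
  obtain ⟨κ, -, hκ⟩ := hl
  have hvκ : v κ = ((v κ).toNat : ℤ) := (Int.toNat_of_nonneg (hv κ)).symm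
  rw [hvκ, seg_natCast, List.mem_replicate] at hκ
  rw [hκ.2]

/-- r12's shell path `Γ_y` (`pathWord lo hi y`) is a forward word for every `y` above the corner `lo − 1` (step of the proof of the
p. 193 surface-gauge bound). [cite: Balaban1989LargeFieldI, p.193] -/
theorem forward_of_mem_pathWord {lo hi y : Fin d → ℤ} (hy : lo - 1 ≤ y) {l : Letter d} (hl : l ∈ pathWord lo hi y) :
    l = (l.1, true) := by
  have hy' : ∀ κ, lo κ - 1 ≤ y κ := fun κ => by
    have h := hy κ; rwa [Pi.sub_apply, Pi.one_apply] at h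
  have hUp : 0 ≤ vUp lo hi y := fun κ => by
    simp only [Pi.zero_apply, vUp]
    split_ifs <;> linarith [hy' κ]
  have hLo : 0 ≤ vLo lo hi y := fun κ => by
    simp only [Pi.zero_apply, vLo]
    split_ifs <;> linarith [hy' κ]
  unfold pathWord at hl
  rcases List.mem_append.1 hl with h | h
  · exact forward_of_mem_tw hUp h
  · exact forward_of_mem_tw hLo h

omit [GaugeGroup G] in
/-- A frozen coordinate stays frozen under a step in another direction (r12's private `Frozen.add_e`, restated). [folklore] -/
private theorem frozen_add_e {lo hi : Fin d → ℤ} {κ₀ : Fin d} {z : Fin d → ℤ} (h : Frozen lo hi κ₀ z) {κ : Fin d} (hκ : κ₀ ≠ κ) :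
    Frozen lo hi κ₀ (z + e κ) := by
  unfold Frozen at h ⊢
  rw [Pi.add_apply, e_apply, if_neg hκ, add_zero]
  exact h

/-- **THE CLAMP.**  From a configuration `V` on `ℤ^d` satisfying the LOCAL plaquette hypothesis — every plaquette of the big box
`[lo − 1, hi + 1]` based at a point with a frozen coordinate outside its two directions is `ε`-small (`0 ≤ ε`, `lo ≤ hi`) — one
gets a configuration `V♭` EQUAL TO `V` on the bonds of the big box and satisfying r12's GLOBAL hypothesis
`ShellPlaqSmall V♭ lo hi ε`: `V♭(z, μ) = V(c z, μ)` if the coordinate-wise clamp `c` onto the big box maps `⟨z, z + e_μ⟩` to a bond,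
`= 1` if it collapses it; a plaquette of `V♭` is a plaquette of `V` inside the big box (same frozen coordinate) or has holonomy `1`
(device reducing print's local hypothesis *"p′ ⊂ Z∩Λ^c"* to r12's global one; step of the proof of the p. 193 bound). [cite: Balaban1989LargeFieldI, p.193] -/
theorem exists_clamped {V : (Fin d → ℤ) → Fin d → G} {lo hi : Fin d → ℤ} {ε : ℝ} (hlohi : lo ≤ hi) (hε : 0 ≤ ε)
    (hV : ∀ (z : Fin d → ℤ) (κ ν κ₀ : Fin d), κ ≠ ν → κ₀ ≠ κ → κ₀ ≠ ν → Frozen lo hi κ₀ z →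
      lo - 1 ≤ z → z + e κ + e ν ≤ hi + 1 → dist1 (hol V z (plaqWord κ ν)) ≤ ε) :
    ∃ V' : (Fin d → ℤ) → Fin d → G,
      (∀ (z : Fin d → ℤ) (μ : Fin d), lo - 1 ≤ z → z + e μ ≤ hi + 1 → V' z μ = V z μ) ∧ ShellPlaqSmall V' lo hi ε := by
  classical
  -- the clamp onto the big box and the bonds it does not collapse
  let c : (Fin d → ℤ) → (Fin d → ℤ) := fun z κ => max (lo κ - 1) (min (hi κ + 1) (z κ))
  let ok : (Fin d → ℤ) → Fin d → Prop := fun z μ => lo μ - 1 ≤ z μ ∧ z μ ≤ hi μ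
  have hc_apply : ∀ z κ, c z κ = max (lo κ - 1) (min (hi κ + 1) (z κ)) := fun _ _ => rfl
  have hlh : ∀ κ, lo κ - 1 ≤ hi κ + 1 := fun κ => by linarith [hlohi κ]
  have hc_lo : ∀ z, lo - 1 ≤ c z := fun z κ => by rw [Pi.sub_apply, Pi.one_apply, hc_apply]; exact le_max_left _ _
  have hc_hi : ∀ z, c z ≤ hi + 1 := fun z κ => by
    rw [Pi.add_apply, Pi.one_apply, hc_apply]
    exact max_le (hlh κ) (min_le_left _ _)
  have hc_id : ∀ z, lo - 1 ≤ z → z ≤ hi + 1 → c z = z := fun z h1 h2 => by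
    funext κ
    have h1κ := h1 κ; have h2κ := h2 κ
    rw [Pi.sub_apply, Pi.one_apply] at h1κ
    rw [Pi.add_apply, Pi.one_apply] at h2κ
    rw [hc_apply, min_eq_right h2κ, max_eq_right h1κ]
  -- the clamp of a non-collapsed bond is a bond, of a collapsed bond a point
  have hc_ok : ∀ z μ, ok z μ → c (z + e μ) = c z + e μ := fun z μ h => by
    funext κ
    rw [Pi.add_apply, hc_apply, hc_apply, Pi.add_apply, e_apply]
    split_ifs with hκ
    · subst hκ
      obtain ⟨h1, h2⟩ := h
      rw [min_eq_right (by linarith), max_eq_right (by linarith), min_eq_right (by linarith), max_eq_right h1]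
    · rw [add_zero, add_zero]
  have hc_not : ∀ z μ, ¬ ok z μ → c (z + e μ) = c z := fun z μ h => by
    funext κ
    rw [hc_apply, hc_apply, Pi.add_apply, e_apply]
    split_ifs with hκ
    · subst hκ
      simp only [ok, not_and_or, not_le] at h
      rcases h with h | h
      · rw [min_eq_right (by linarith [hlh κ]), min_eq_right (by linarith [hlh κ]), max_eq_left (by linarith),
          max_eq_left (by linarith)]
      · rw [min_eq_left (by linarith), min_eq_left (by linarith)]
    · rw [add_zero]
  have hok_add : ∀ z κ μ, κ ≠ μ → (ok (z + e κ) μ ↔ ok z μ) := fun z κ μ hκμ => by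
    simp only [ok, Pi.add_apply, e_apply, if_neg hκμ.symm, add_zero]
  have hc_frozen : ∀ {κ₀ z}, Frozen lo hi κ₀ z → Frozen lo hi κ₀ (c z) := fun {κ₀ z} h => by
    unfold Frozen at h ⊢
    rw [hc_apply]
    rcases h with h | h
    · left; rw [h, min_eq_right (hlh κ₀), max_self]
    · right; rw [h, min_self, max_eq_right (hlh κ₀)]
  -- the clamped configuration
  refine ⟨fun z μ => if ok z μ then V (c z) μ else 1, fun z μ h1 h2 => ?_, fun z κ ν κ₀ hκν h0κ h0ν hz => ?_⟩
  · -- agreement on the bonds of the big box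
    have h2' : z ≤ hi + 1 := (le_add_of_nonneg_right (e_nonneg μ)).trans h2
    have hok : ok z μ := by
      refine ⟨by have := h1 μ; rwa [Pi.sub_apply, Pi.one_apply] at this, ?_⟩
      have := h2 μ
      rw [Pi.add_apply, e_apply, if_pos rfl, Pi.add_apply, Pi.one_apply] at this
      linarith
    simp only [if_pos hok, hc_id z h1 h2']
  · -- the global plaquette hypothesis for the clamped configuration
    rw [hol_plaqWord_eq]
    simp only [hok_add z κ ν hκν, hok_add z ν κ hκν.symm]
    by_cases hκ : ok z κ <;> by_cases hν : ok z ν <;> simp only [hκ, hν, if_true, if_false]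
    · -- both directions genuine: a plaquette of `V` inside the big box with the frozen coordinate `κ₀`
      rw [hc_ok z κ hκ, hc_ok z ν hν, ← hol_plaqWord_eq]
      refine hV (c z) κ ν κ₀ hκν h0κ h0ν (hc_frozen hz) (hc_lo z) fun j => ?_
      rw [Pi.add_apply, Pi.add_apply, Pi.add_apply, Pi.one_apply, e_apply, e_apply]
      have hj := hc_hi z j
      rw [Pi.add_apply, Pi.one_apply] at hj
      split_ifs with h1 h2 h2
      · exact absurd (h1.symm.trans h2) hκν
      · subst h1
        have : c z j = z j := by rw [hc_apply, min_eq_right (by linarith [hκ.2]), max_eq_right hκ.1]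
        linarith [hκ.2]
      · subst h2
        have : c z j = z j := by rw [hc_apply, min_eq_right (by linarith [hν.2]), max_eq_right hν.1]
        linarith [hν.2]
      · linarith
    · -- direction `ν` collapsed: holonomy `V(c z, κ) V(c z, κ)⁻¹ = 1`
      simp only [hc_not z ν hν, mul_one, inv_one, mul_inv_cancel, GaugeGroup.dist1_one]
      exact hε
    · -- direction `κ` collapsed
      simp only [hc_not z κ hκ, one_mul, mul_one, inv_one, mul_inv_cancel, GaugeGroup.dist1_one]
      exact hε
    · -- both collapsed
      simp only [mul_one, inv_one, GaugeGroup.dist1_one]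
      exact hε

/-- Two configurations agreeing on the bonds of the big box have the same shell gauge function `g(y) = V(Γ_y)` at every point
`y` of the big box (the shell path is a forward word from `lo − 1` to `y`). [cite: Balaban1989LargeFieldI, p.193] -/
theorem shellFn_congr {V V' : (Fin d → ℤ) → Fin d → G} {lo hi : Fin d → ℤ}
    (hV' : ∀ (z : Fin d → ℤ) (μ : Fin d), lo - 1 ≤ z → z + e μ ≤ hi + 1 → V' z μ = V z μ) {y : Fin d → ℤ}
    (hy : lo - 1 ≤ y) (hy' : y ≤ hi + 1) : shellFn V' lo hi y = shellFn V lo hi y := by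
  unfold shellFn
  refine hol_congr_of_forward V V' (pathWord lo hi y) (lo - 1) (fun l hl => forward_of_mem_pathWord hy hl)
    fun z μ hz hz' => hV' z μ hz ?_
  rw [bot_add_disp_pathWord] at hz'
  exact hz'.trans hy'

/-- … hence the same gauge-transformed bond variables `g(y)V(y, y + e_μ)g(y + e_μ)⁻¹` on the bonds of the big box.
[cite: Balaban1989LargeFieldI, p.193] -/
theorem gaugeAct_shellFn_congr {V V' : (Fin d → ℤ) → Fin d → G} {lo hi : Fin d → ℤ}
    (hV' : ∀ (z : Fin d → ℤ) (μ : Fin d), lo - 1 ≤ z → z + e μ ≤ hi + 1 → V' z μ = V z μ) {y : Fin d → ℤ} {μ : Fin d}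
    (hy : lo - 1 ≤ y) (hyμ : y + e μ ≤ hi + 1) :
    gaugeAct (shellFn V' lo hi) V' y μ = gaugeAct (shellFn V lo hi) V y μ := by
  have hy' : y ≤ hi + 1 := (le_add_of_nonneg_right (e_nonneg μ)).trans hyμ
  have hlo' : lo - 1 ≤ y + e μ := hy.trans (le_add_of_nonneg_right (e_nonneg μ))
  unfold gaugeAct
  rw [shellFn_congr hV' hy hy', shellFn_congr hV' hlo' hyμ, hV' y μ hy hyμ]

/-- **THE SHELL-BOND BOUND ON `ℤ^d` UNDER THE LOCAL HYPOTHESIS** (*"|V′_k(b′) − 1| < O(1)M²ε"*, p. 193; `d ≥ 3`): if the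
plaquettes OF THE BIG BOX `[lo − 1, hi + 1]` based at a point with a frozen coordinate outside their two directions are `ε`-small,
then in r12's shell gauge every bond `⟨y, y + e_μ⟩` of the big box with both ends in the shell has `|V^g(b) − 1| ≤ 3d(n + 2)²ε` —
`B15ShellGauge193.dist1_shellAct_le` applied to the clamped configuration of `exists_clamped`. [cite: Balaban1989LargeFieldI, p.193] -/
theorem dist1_shellAct_le_local {V : (Fin d → ℤ) → Fin d → G} {lo hi : Fin d → ℤ} {ε : ℝ}
    (hV : ∀ (z : Fin d → ℤ) (κ ν κ₀ : Fin d), κ ≠ ν → κ₀ ≠ κ → κ₀ ≠ ν → Frozen lo hi κ₀ z →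
      lo - 1 ≤ z → z + e κ + e ν ≤ hi + 1 → dist1 (hol V z (plaqWord κ ν)) ≤ ε)
    (hε : 0 ≤ ε) (hd : 3 ≤ d) (hlohi : lo ≤ hi) {n : ℕ} (hn : ∀ κ, hi κ ≤ lo κ + n) {y : Fin d → ℤ} {μ : Fin d}
    (hy : lo - 1 ≤ y) (hyμ : y + e μ ≤ hi + 1) (hyS : ∃ κ₀, Frozen lo hi κ₀ y) (hyS' : ∃ κ₀, Frozen lo hi κ₀ (y + e μ)) :
    dist1 (gaugeAct (shellFn V lo hi) V y μ) ≤ 3 * d * (n + 2) ^ 2 * ε := by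
  obtain ⟨V', hV'V, hV'⟩ := exists_clamped hlohi hε hV
  rw [← gaugeAct_shellFn_congr hV'V hy hyμ]
  exact dist1_shellAct_le hV' hε hd hlohi hn hy hyμ hyS hyS'

end Zd

/-! ## §2  Torus: r12's shell gauge of a parallelepiped under the local plaquette hypothesis -/

section Torus

variable {P : Params} {k : ℕ} {G : Type*} [GaugeGroup G] {lo hi : Fin P.d → ℤ}

open T4AxialGaugeSmallField (castSite castSite_apply castSite_add_e pull pull_apply hol_pull_plaqWord_of_lt
  hol_pull_plaqWord_of_gt boxPlaqs)
open B15Extension193 (boxSites outBonds corners outPlaqs mem_corners_iff extend extend_eq_of_mem_outBonds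
  plaqHol_extend_of_mem_outPlaqs castSite_inj_big)
open B15ShellGauge193 (castSite_not_mem_boxSites_of_frozen shellGauge gaugeAct_shellGauge_castSite shellSites
  corners_subset_of_not_mem_outPlaqs dist1_plaqHol_extend_le_of_corners)

omit [GaugeGroup G] in
/-- THE PULL-BACK DICTIONARY for the local hypothesis: a `ℤ^d` plaquette of the big box `[lo − 1, hi + 1]` based at a point with a
frozen coordinate outside its two directions is, on the torus, a plaquette of `boxPlaqs (lo − 1) (hi + 1)` with no corner in
`Λ = boxSites lo hi` (r12's `castSite_not_mem_boxSites_of_frozen` at each corner). [cite: Balaban1989LargeFieldI, p.193] -/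
theorem plaq_mem_local_of_frozen (hlohi : lo ≤ hi) (hN : ∀ κ, hi κ - lo κ + 3 < (P.sitesPerDir k : ℤ))
    {z : Fin P.d → ℤ} {a b κ₀ : Fin P.d} (hab : a < b) (ha : κ₀ ≠ a) (hb : κ₀ ≠ b) (hz : Frozen lo hi κ₀ z)
    (hlo : lo - 1 ≤ z) (hhi : z + e a + e b ≤ hi + 1) :
    (⟨castSite z, a, b, hab⟩ : Plaq P k) ∈ (boxPlaqs (lo - 1) (hi + 1) : Set (Plaq P k)) ∧
      (⟨castSite z, a, b, hab⟩ : Plaq P k) ∈ outPlaqs (boxSites (k := k) lo hi) := by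
  refine ⟨⟨z, hlo, hhi, rfl⟩, fun c hc => ?_⟩
  rw [mem_corners_iff] at hc
  simp only at hc
  rcases hc with rfl | rfl | rfl | rfl
  · exact castSite_not_mem_boxSites_of_frozen hlohi hN hz
  · rw [← castSite_add_e]
    exact castSite_not_mem_boxSites_of_frozen hlohi hN (frozen_add_e hz ha)
  · rw [← castSite_add_e]
    exact castSite_not_mem_boxSites_of_frozen hlohi hN (frozen_add_e hz hb)
  · rw [← castSite_add_e, ← castSite_add_e]
    exact castSite_not_mem_boxSites_of_frozen hlohi hN (frozen_add_e (frozen_add_e hz ha) hb)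

/-- **THE LOCAL TORUS HYPOTHESIS GIVES THE LOCAL `ℤ^d` ONE**: `|U(∂p′) − 1| < ε` on a plaquette set `S₀` containing every
plaquette of the enlarged box `boxPlaqs (lo − 1) (hi + 1)` without a corner in `Λ = boxSites lo hi` (print's *"p′ ⊂ Z∩Λ^c"* with
`Z ⊇` the enlarged box) implies the big-box plaquette hypothesis for `pull U`. [cite: Balaban1989LargeFieldI, p.193] -/
theorem shellPlaqSmallIn_pull (hlohi : lo ≤ hi) (hN : ∀ κ, hi κ - lo κ + 3 < (P.sitesPerDir k : ℤ)) {ε : ℝ}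
    {S₀ : Set (Plaq P k)}
    (hS₀ : ∀ p ∈ (boxPlaqs (lo - 1) (hi + 1) : Set (Plaq P k)), p ∈ outPlaqs (boxSites (k := k) lo hi) → p ∈ S₀)
    {U : GaugeField P k G} (hU : PlaqSmallOn S₀ ε U) :
    ∀ (z : Fin P.d → ℤ) (κ ν κ₀ : Fin P.d), κ ≠ ν → κ₀ ≠ κ → κ₀ ≠ ν → Frozen lo hi κ₀ z →
      lo - 1 ≤ z → z + e κ + e ν ≤ hi + 1 → dist1 (hol (pull U) z (plaqWord κ ν)) ≤ ε := by
  intro z κ ν κ₀ hκν h0κ h0ν hz hlo hhi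
  rcases lt_or_gt_of_ne hκν with h | h
  · obtain ⟨h1, h2⟩ := plaq_mem_local_of_frozen (k := k) hlohi hN h h0κ h0ν hz hlo hhi
    rw [hol_pull_plaqWord_of_lt U z h]
    exact (hU _ (hS₀ _ h1 h2)).le
  · obtain ⟨h1, h2⟩ := plaq_mem_local_of_frozen (k := k) hlohi hN h h0ν h0κ hz hlo (by rwa [add_right_comm])
    rw [hol_pull_plaqWord_of_gt U z h, GaugeGroup.dist1_inv]
    exact (hU _ (hS₀ _ h1 h2)).le

/-- **THE SHELL-GAUGE BOUND ON THE TORUS, LOCAL HYPOTHESIS** (*"|V′_k(b′) − 1| < O(1)M²ε"*, p. 193, every bond with both ends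
in the shell of the parallelepiped, `d ≥ 3`, `O(1)M² ↤ 3d(n + 2)²`): r12's `dist1_gaugeAct_shellGauge_le` with
`PlaqSmallOn (outPlaqs Λ) ε U` weakened to `PlaqSmallOn S₀ ε U`, `S₀ ⊇ boxPlaqs (lo − 1) (hi + 1) ∩ outPlaqs Λ`.
[cite: Balaban1989LargeFieldI, p.193] -/
theorem dist1_gaugeAct_shellGauge_le_local (hd : 3 ≤ P.d) (hlohi : lo ≤ hi) {n : ℕ} (hn : ∀ κ, hi κ ≤ lo κ + n)
    (hN : ∀ κ, hi κ - lo κ + 3 < (P.sitesPerDir k : ℤ)) {ε : ℝ} (hε : 0 ≤ ε) {S₀ : Set (Plaq P k)}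
    (hS₀ : ∀ p ∈ (boxPlaqs (lo - 1) (hi + 1) : Set (Plaq P k)), p ∈ outPlaqs (boxSites (k := k) lo hi) → p ∈ S₀)
    {U : GaugeField P k G} (hU : PlaqSmallOn S₀ ε U) {b : PBond P k} (hs : b.src ∈ shellSites lo hi)
    (ht : b.tgt ∈ shellSites lo hi) :
    dist1 (GaugeField.gaugeAct (shellGauge U lo hi) U b) ≤ 3 * P.d * (n + 2) ^ 2 * ε := by
  obtain ⟨x, hx, hx', ⟨κ₀, hκ₀⟩, hsrc⟩ := hs
  obtain ⟨x', hy, hy', ⟨κ₁, hκ₁⟩, htgt⟩ := ht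
  obtain ⟨src, dir⟩ := b
  simp only at hsrc
  subst hsrc
  have htgt' : (castSite x' : Site P k) = castSite (x + e dir) := by rw [castSite_add_e]; exact htgt
  have e1 : ∀ κ, lo κ - 1 ≤ x' κ := fun κ => by
    have h := hy κ; rwa [Pi.sub_apply, Pi.one_apply] at h
  have e2 : ∀ κ, x' κ ≤ hi κ + 2 := fun κ => by
    have h : x' κ ≤ (hi + 1) κ := hy' κ
    rw [Pi.add_apply, Pi.one_apply] at h
    linarith
  have e3 : ∀ κ, lo κ - 1 ≤ (x + e dir) κ := fun κ => by
    have h : (lo - 1) κ ≤ x κ := hx κ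
    rw [Pi.sub_apply, Pi.one_apply] at h
    have h0 : (0 : ℤ) ≤ e dir κ := e_nonneg dir κ
    rw [Pi.add_apply]
    linarith
  have e4 : ∀ κ, (x + e dir) κ ≤ hi κ + 2 := fun κ => by
    have h : x κ ≤ (hi + 1) κ := hx' κ
    rw [Pi.add_apply, Pi.one_apply] at h
    have h0 : e dir κ ≤ (1 : ℤ) := by rw [e_apply]; split_ifs <;> simp
    rw [Pi.add_apply]
    linarith
  have heq : x' = x + e dir := castSite_inj_big hN e1 e2 e3 e4 htgt'
  subst heq
  rw [gaugeAct_shellGauge_castSite U hN hx hy']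
  exact dist1_shellAct_le_local (shellPlaqSmallIn_pull hlohi hN hS₀ hU) hε hd hlohi hn hx hy' ⟨κ₀, hκ₀⟩ ⟨κ₁, hκ₁⟩

/-- **THE EXTENSION LEMMA OF p. 193 FOR A PARALLELEPIPED, ALL PLAQUETTES, LOCAL HYPOTHESIS** (`d ≥ 3`): for
`Λ = boxSites lo hi` (at most `n + 1` sites per direction, non-wrapping with margin) and `V` with `|V(∂p′) − 1| < ε` on a
plaquette set `S₀ ⊇ boxPlaqs (lo − 1) (hi + 1) ∩ outPlaqs Λ` (the plaquettes of the enlarged box off `Λ` — print's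
*"p′ ⊂ Z∩Λ^c"*), r12's extension `V̂ = extend Λ (shellGauge V lo hi) V` (i) equals `V` on the bonds of `Λᶜ`, (ii) keeps the
plaquette variables of `Λᶜ`, (iii) has `|V̂(∂p) − 1| ≤ 12d(n + 2)²ε` on every other plaquette — `B15ShellGauge193.extension_shell_box`
under the local hypothesis. [cite: Balaban1989LargeFieldI, p.193] -/
theorem extension_shell_box_local (hd : 3 ≤ P.d) (V : GaugeField P k G) (hlohi : lo ≤ hi) {n : ℕ}
    (hn : ∀ κ, hi κ ≤ lo κ + n) (hN : ∀ κ, hi κ - lo κ + 3 < (P.sitesPerDir k : ℤ)) {ε : ℝ} (hε : 0 ≤ ε)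
    {S₀ : Set (Plaq P k)}
    (hS₀ : ∀ p ∈ (boxPlaqs (lo - 1) (hi + 1) : Set (Plaq P k)), p ∈ outPlaqs (boxSites (k := k) lo hi) → p ∈ S₀)
    (hV : PlaqSmallOn S₀ ε V) :
    (∀ b ∈ outBonds (boxSites lo hi), extend (boxSites lo hi) (shellGauge V lo hi) V b = V b) ∧
      (∀ p ∈ outPlaqs (boxSites lo hi),
        GaugeField.plaqHol (extend (boxSites lo hi) (shellGauge V lo hi) V) p = GaugeField.plaqHol V p) ∧
      ∀ p ∉ outPlaqs (boxSites lo hi),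
        dist1 (GaugeField.plaqHol (extend (boxSites lo hi) (shellGauge V lo hi) V) p) ≤
          4 * (3 * P.d * (n + 2) ^ 2 * ε) :=
  ⟨fun _ hb => extend_eq_of_mem_outBonds _ V hb, fun _ hp => plaqHol_extend_of_mem_outPlaqs _ V hp,
    fun _ hp => dist1_plaqHol_extend_le_of_corners (T := shellSites lo hi) (shellGauge V lo hi) V (by positivity)
      (fun _ hs ht => dist1_gaugeAct_shellGauge_le_local hd hlohi hn hN hε hS₀ hV hs ht)
      (corners_subset_of_not_mem_outPlaqs hp)⟩

end Torus

/-! ## §3  At the carrier of record `B15Prop1Carrier.lfVarOn`: the extension letters `hext0` ∕ `hextZ` ∕ `hextΛ` of Proposition 1 -/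

section Carrier

variable {P : Params} {k : ℕ} {G : Type*} [GaugeGroup G] {lo hi : Fin P.d → ℤ}

open T4AxialGaugeSmallField (castSite boxPlaqs)
open B15Extension193 (boxSites outBonds corners outPlaqs mem_corners_iff extend extend_eq_of_mem_outBonds)
open B15ShellGauge193 (shellGauge)
open B15DeterminingSets (pts bondsOf)
open B15Prop1Carrier (extSet plaqsInside mem_plaqsInside_compl_iff mem_plaqsInside_inter_iff pts_inter_compl)
open B8Eq17ClassAkV1 (plaqsOf mem_plaqsOf)
open GaugeField (plaqHol)

omit [GaugeGroup G] in
/-- r12's `boxSites lo hi` is the image `castSite '' [lo, hi]` (the form of `B15Prop1RelativeAxialGauge` ∕ `B15Prop1CarrierOnSU2Box`'s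
`hbox : pts k Λ = castSite '' Set.Icc lo hi`). [folklore] -/
private theorem boxSites_eq_image (lo hi : Fin P.d → ℤ) : (boxSites lo hi : Set (Site P k)) = castSite '' Set.Icc lo hi := by
  ext y
  simp only [boxSites, Set.mem_setOf_eq, Set.mem_image, Set.mem_Icc]
  constructor
  · rintro ⟨x, h1, h2, h3⟩; exact ⟨x, ⟨h1, h2⟩, h3⟩
  · rintro ⟨x, ⟨h1, h2⟩, h3⟩; exact ⟨x, h1, h2, h3⟩

omit [GaugeGroup G] in
/-- The plaquettes of `Λᶜ` (`B15Extension193.outPlaqs`: all four corners off `Λ`) are exactly the plaquettes NOT meeting `Λ` in the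
corner-meeting convention `B8Eq17ClassAkV1.plaqsOf` of (1.78)'s *"p′ ∈ Λ"*. [cite: Balaban1989LargeFieldI, p.193, Prop. 1 (1.78) p.194] -/
theorem mem_outPlaqs_iff_not_mem_plaqsOf (Λs : Set (Site P k)) (p : Plaq P k) : p ∈ outPlaqs Λs ↔ p ∉ plaqsOf Λs := by
  rw [mem_plaqsOf]
  simp only [outPlaqs, Set.mem_setOf_eq, mem_corners_iff, not_or]
  constructor
  · intro h
    exact ⟨h _ (Or.inl rfl), h _ (Or.inr (Or.inl rfl)), h _ (Or.inr (Or.inr (Or.inl rfl))),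
      h _ (Or.inr (Or.inr (Or.inr rfl)))⟩
  · rintro ⟨h1, h2, h3, h4⟩ c hc
    rcases hc with rfl | rfl | rfl | rfl <;> assumption

/-- **LETTER `hext0` OF `B15Prop1CarrierOnSU2Box.prop1Printed_lfVarOn_su2_box_slice`, DISCHARGED for the p. 193 extension
(any `Λ`, any surface gauge `g`): *"equal to the given one on Z∩Λ^c"* — the extension `extend Λ g V_k` lies in
`extSet (bondsOf Λ) V_k`, i.e. equals `V_k` off the bonds meeting `Λ`. [cite: Balaban1989LargeFieldI, p.193, Prop. 1 p.194] -/
theorem extend_mem_extSet (Λs : Set (Site P k)) (g : GaugeTransf P k G) (V : GaugeField P k G) :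
    extend Λs g V ∈ extSet (bondsOf Λs) V := fun _ hb =>
  extend_eq_of_mem_outBonds g V ⟨fun h => hb (Or.inl h), fun h => hb (Or.inr h)⟩

/-- **LETTERS `hextZ` ∕ `hextΛ` OF PROPOSITION 1 AT THE CARRIER OF RECORD, DISCHARGED** (`d ≥ 3`, parallelepiped
`Λ^{(k)} = castSite '' [lo, hi]` of at most `n + 1` sites per direction, non-wrapping with margin, enlarged box inside `Z^{(k)}`):
under `lfVarOn`'s regularity `PlaqSmallOn (plaqsInside (pts k (Z ∩ Λᶜ))) ε V_k` (print's *"|V_k(∂p′) − 1| < ε for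
p′ ⊂ (Z∩Λ^c)^{(k)}"*, `0 < ε`, NO smallness threshold) the p. 193 extension `V̂ = extend (pts k Λ) (shellGauge V_k lo hi) V_k`
satisfies `|V̂(∂p′) − 1| ≤ 12d(n + 2)²ε` for EVERY plaquette `p′ ⊂ Z^{(k)}` and for every plaquette meeting `Λ^{(k)}`.
[cite: Balaban1989LargeFieldI, p.193, Prop. 1 (1.78) p.194] -/
theorem dist1_plaqHol_extend_shellGauge_le (hd : 3 ≤ P.d) (hlohi : lo ≤ hi) {n : ℕ} (hn : ∀ κ, hi κ ≤ lo κ + n)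
    (hN : ∀ κ, hi κ - lo κ + 3 < (P.sitesPerDir k : ℤ)) {Z Λ : Set (Site P 0)}
    (hbox : pts k Λ = (castSite '' Set.Icc lo hi : Set (Site P k)))
    (hZ : (boxPlaqs (lo - 1) (hi + 1) : Set (Plaq P k)) ⊆ plaqsInside (pts k Z))
    {ε : ℝ} (hε : 0 < ε) {V : GaugeField P k G} (hreg : PlaqSmallOn (plaqsInside (pts k (Z ∩ Λᶜ))) ε V) :
    (∀ p ∈ plaqsInside (pts k Z),
        dist1 (plaqHol (extend (pts k Λ) (shellGauge V lo hi) V) p) ≤ 12 * P.d * (n + 2) ^ 2 * ε) ∧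
      ∀ p ∈ plaqsOf (pts k Λ),
        dist1 (plaqHol (extend (pts k Λ) (shellGauge V lo hi) V) p) ≤ 12 * P.d * (n + 2) ^ 2 * ε := by
  have hΛ : pts k Λ = boxSites lo hi := hbox.trans (boxSites_eq_image lo hi).symm
  have hout : ∀ p : Plaq P k, p ∈ outPlaqs (boxSites (k := k) lo hi) → p ∈ plaqsInside (pts k Z) →
      p ∈ plaqsInside (pts k (Z ∩ Λᶜ)) := by
    intro p hp hpZ
    rw [pts_inter_compl, mem_plaqsInside_inter_iff, mem_plaqsInside_compl_iff, hΛ]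
    exact ⟨hpZ, (mem_outPlaqs_iff_not_mem_plaqsOf _ p).1 hp⟩
  have hS₀ : ∀ p ∈ (boxPlaqs (lo - 1) (hi + 1) : Set (Plaq P k)), p ∈ outPlaqs (boxSites (k := k) lo hi) →
      p ∈ plaqsInside (pts k (Z ∩ Λᶜ)) := fun p hp hp' => hout p hp' (hZ hp)
  obtain ⟨-, hplaq, hrest⟩ := extension_shell_box_local hd V hlohi hn hN hε.le hS₀ hreg
  have hc : 4 * (3 * (P.d : ℝ) * (n + 2) ^ 2 * ε) = 12 * P.d * (n + 2) ^ 2 * ε := by ring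
  have hε' : ε ≤ 12 * P.d * (n + 2) ^ 2 * ε := by
    have hd' : (3 : ℝ) ≤ P.d := by exact_mod_cast hd
    have h4 : (4 : ℝ) ≤ ((n : ℝ) + 2) ^ 2 := by nlinarith [(n.cast_nonneg : (0 : ℝ) ≤ n)]
    have h1 : (1 : ℝ) ≤ 12 * P.d * (n + 2) ^ 2 := by nlinarith
    exact le_mul_of_one_le_left hε.le h1
  rw [hΛ]
  refine ⟨fun p hpZ => ?_, fun p hpΛ => ?_⟩
  · by_cases hp : p ∈ outPlaqs (boxSites (k := k) lo hi)
    · rw [hplaq p hp]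
      exact (hreg p (hout p hp hpZ)).le.trans hε'
    · rw [← hc]
      exact hrest p hp
  · have hp : p ∉ outPlaqs (boxSites (k := k) lo hi) := fun h => (mem_outPlaqs_iff_not_mem_plaqsOf _ p).1 h hpΛ
    rw [← hc]
    exact hrest p hp

end Carrier

end Literature.MathematicalPhysics.QuantumFieldTheory.Balaban1983to89.B15ShellGauge193Local

end
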